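import Summits.RiemannHypothesis.RiemannHypothesis.Theorems.WindowTraceArch.Negative.LocalWeyl
import Literature.Analysis.FunctionSpaces.TorusFourierSeries
import Mathlib.Analysis.PSeries
import HarnessLib

/-!
# `WindowStep`, line `christoffel-margin` — stub `stub_farTail`

Support file for the crux `stmt-RiemannHypothesis-14659`
(`Summit.RiemannHypothesis.RiemannHypothesis.Theses.SpectralTrace.WindowStep`), line
`christoffel-margin`: the FAR TAIL estimate for real families `γ : ι → ℝ` reproducing the Weil
functional on the Weil tests supported in a window `[-A, A]`, fed the uniform upper local Weyl law
(the hypothesis, proved separately as `stub_upperLawUniform`):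

* `stub_farTail` : given `∀ A > 0, ∃ C > 0, ∀ ι γ, (γ reproduces W on [-A, A]) → ∀ T s,
  (∀ i ∈ s, |γ_i - T| ≤ 1) → #s ≤ C (1 + log(1 + |T|))`, for every `A > 0`, every Weil test `w`
  and every `ε > 0` there is `R > 0` (depending on `A, w, ε` only) such that for every such family,
  every `T` and every finite set `F` of indices with `|γ_i - T| > R`,
  `Σ_{i ∈ F} ‖ŵ(1/2 + i(γ_i - T))‖² ≤ ε (1 + log(1 + |T|))`.

Proof. Sort `F` into the unit windows around `T + m`, `m = round (γ_i - T) ∈ ℤ`. The window of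
`m` holds at most `C (1 + log(1 + |T + m|)) ≤ C (1 + log(1 + |T|)) (1 + |m|)` indices (the
hypothesis at height `T + m`, `log(1 + |T + m|) ≤ log(1 + |T|) + log(1 + |m|) ≤ log(1 + |T|) + |m|`),
and each of its indices costs, with `v = γ_i - T`, `|v| > R ≥ 1`, `|v - m| ≤ 1/2`,
`‖ŵ(1/2 + iv)‖² ≤ D² (1 + v²)⁻² ≤ 8 D² / (R (1 + |m|) (1 + m²))` (`norm_sq_weilMellin_half_line_le`,
`D = weilDecayW 0 w`, and the elementary `(1 + v²)² ≥ (R (1 + |m|)/4) · ((1 + m²)/2)`). Hence the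
window of `m` contributes at most `8 C D² (1 + log(1 + |T|)) / (R (1 + m²))`, and summing over the
finitely many windows against `S = Σ_{m ∈ ℤ} (1 + m²)⁻¹ < ∞`
(`Literature.Analysis.FunctionSpaces.Torus.summable_inv_one_add_sq_int`) gives the bound
`8 C D² S (1 + log(1 + |T|)) / R ≤ ε (1 + log(1 + |T|))` once `R = max 1 (8 C D² S / ε)`.
-/

set_option linter.dupNamespace false

noncomputable section

open Complex Set MeasureTheory Filter
open scoped Real Topology

namespace Summit.RiemannHypothesis.RiemannHypothesis.Theorems.SpectralTraceWindowStep

open Literature.NumberTheory.LFunctions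
open Summit.RiemannHypothesis.RiemannHypothesis.Theorems.WindowTraceArch.Negative

/-- The elementary window inequality: if `|v| > R ≥ 1` and `|v - m| ≤ 1/2` then
`(1 + v²)⁻² ≤ 8 / (R (1 + |m|) (1 + m²))`, from `1 + v² ≥ (1 + m²)/2` and
`1 + v² ≥ |v|·|v| ≥ R (1 + |m|)/4`. [folklore] -/
theorem inv_one_add_sq_sq_le {R v m : ℝ} (hR : 1 ≤ R) (hv : R < |v|) (hvm : |v - m| ≤ 1 / 2) :
    ((1 + v ^ 2)⁻¹) ^ 2 ≤ 8 / (R * (1 + |m|) * (1 + m ^ 2)) := by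
  obtain ⟨hd1, hd2⟩ := abs_le.mp hvm
  have h1 : (1 + m ^ 2) / 2 ≤ 1 + v ^ 2 := by
    nlinarith [sq_nonneg (2 * v - m),
      mul_nonneg (by linarith : (0 : ℝ) ≤ 1 / 2 - (v - m)) (by linarith : (0 : ℝ) ≤ v - m + 1 / 2)]
  have hmv : |m| ≤ |v| + 1 / 2 := by
    have h := abs_sub_abs_le_abs_sub m v
    rw [abs_sub_comm] at h
    linarith
  have hv1 : 1 ≤ |v| := by linarith
  have h3 : (1 + |m|) / 4 ≤ |v| := by linarith
  have h2 : R * (1 + |m|) / 4 ≤ 1 + v ^ 2 := by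
    have h4 : R * ((1 + |m|) / 4) ≤ |v| * |v| :=
      mul_le_mul hv.le h3 (by positivity) (abs_nonneg _)
    have h5 : |v| * |v| = v ^ 2 := by rw [← sq, sq_abs]
    nlinarith [h4, h5, sq_nonneg v]
  have hpos : 0 < R * (1 + |m|) * (1 + m ^ 2) / 8 := by positivity
  have h12 : R * (1 + |m|) * (1 + m ^ 2) / 8 ≤ (1 + v ^ 2) ^ 2 := by
    have h := mul_le_mul h2 h1 (by positivity) (by positivity)
    calc R * (1 + |m|) * (1 + m ^ 2) / 8 = R * (1 + |m|) / 4 * ((1 + m ^ 2) / 2) := by ring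
      _ ≤ (1 + v ^ 2) * (1 + v ^ 2) := h
      _ = (1 + v ^ 2) ^ 2 := by ring
  calc ((1 + v ^ 2)⁻¹) ^ 2 = ((1 + v ^ 2) ^ 2)⁻¹ := by rw [inv_pow]
    _ ≤ (R * (1 + |m|) * (1 + m ^ 2) / 8)⁻¹ := inv_anti₀ hpos h12
    _ = 8 / (R * (1 + |m|) * (1 + m ^ 2)) := inv_div _ _

/-- The logarithmic count at a shifted height: `1 + log(1 + |T + m|) ≤ (1 + log(1 + |T|)) (1 + |m|)`
(`log(1 + |T + m|) ≤ log(1 + |T|) + log(1 + |m|)` and `log(1 + |m|) ≤ |m|`). [folklore] -/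
theorem one_add_log_abs_add_le (T m : ℝ) :
    1 + Real.log (1 + |T + m|) ≤ (1 + Real.log (1 + |T|)) * (1 + |m|) := by
  have hT : 0 ≤ Real.log (1 + |T|) := Real.log_nonneg (by linarith [abs_nonneg T])
  have h1 : Real.log (1 + |T + m|) ≤ Real.log (1 + |T|) + Real.log (1 + |m|) := by
    rw [← Real.log_mul (by positivity) (by positivity)]
    refine Real.log_le_log (by positivity) ?_
    have h := abs_add_le T m
    nlinarith [abs_nonneg T, abs_nonneg m]
  have h2 : Real.log (1 + |m|) ≤ |m| := by
    have h := Real.log_le_sub_one_of_pos (by positivity : (0 : ℝ) < 1 + |m|)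
    linarith
  nlinarith [mul_nonneg hT (abs_nonneg m)]

/-- **stub_farTail — far atoms carry little of a fixed transform (RH-free).** Given the uniform
upper local Weyl law (the hypothesis): for `A > 0`, a Weil test `w` and `ε > 0` there is `R > 0`
such that for EVERY real family `γ` reproducing `W` on the Weil tests of `[-A, A]`, every `T` and
every finite set `F` of indices with `|γ_i − T| > R`:
`Σ_{i∈F} ‖ŵ(1/2 + i(γ_i − T))‖² ≤ ε (1 + log(1 + |T|))`. Proof: sort `F` into the unit windows
around `T + m`, `m = round (γ_i − T) ∈ ℤ`; the window of `m` holds at most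
`C (1 + log(1+|T+m|)) ≤ C (1 + log(1+|T|)) (1 + |m|)` indices (hypothesis at height `T + m`,
`one_add_log_abs_add_le`) and each of them costs at most `D² (1 + v²)⁻² ≤ 8 D² / (R (1+|m|)(1+m²))`
(`norm_sq_weilMellin_half_line_le`, `D = weilDecayW 0 w`, `inv_one_add_sq_sq_le`); summing the
window bounds `8 C D² (1 + log(1+|T|)) / (R (1 + m²))` against `S = Σ_{m ∈ ℤ} (1+m²)⁻¹`
(`Torus.summable_inv_one_add_sq_int`) gives `8 C D² S (1 + log(1+|T|)) / R ≤ ε (1 + log(1+|T|))` for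
`R = max 1 (8 C D² S / ε)`. [folklore] -/
theorem stub_farTail :
    (∀ A : ℝ, 0 < A → ∃ C : ℝ, 0 < C ∧
      ∀ (ι : Type) (γ : ι → ℝ),
        (∀ g : ℝ → ℂ, Literature.NumberTheory.LFunctions.IsWeilTest g →
          tsupport g ⊆ Set.Icc (-A) A →
            HasSum (fun i => Literature.NumberTheory.LFunctions.weilMellin g (1 / 2 + (γ i : ℂ) * Complex.I))
              (Literature.NumberTheory.LFunctions.weilFunctional g)) →
        ∀ (T : ℝ) (s : Finset ι), (∀ i ∈ s, |γ i - T| ≤ 1) →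
          (s.card : ℝ) ≤ C * (1 + Real.log (1 + |T|))) →
    ∀ A : ℝ, 0 < A → ∀ w : ℝ → ℂ, Literature.NumberTheory.LFunctions.IsWeilTest w →
      ∀ ε : ℝ, 0 < ε → ∃ R : ℝ, 0 < R ∧
        ∀ (ι : Type) (γ : ι → ℝ),
          (∀ g : ℝ → ℂ, Literature.NumberTheory.LFunctions.IsWeilTest g →
            tsupport g ⊆ Set.Icc (-A) A →
              HasSum (fun i => Literature.NumberTheory.LFunctions.weilMellin g (1 / 2 + (γ i : ℂ) * Complex.I))
                (Literature.NumberTheory.LFunctions.weilFunctional g)) →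
          ∀ (T : ℝ) (F : Finset ι), (∀ i ∈ F, R < |γ i - T|) →
            ∑ i ∈ F, ‖Literature.NumberTheory.LFunctions.weilMellin w
                (1 / 2 + ((γ i - T : ℝ) : ℂ) * Complex.I)‖ ^ 2 ≤
              ε * (1 + Real.log (1 + |T|)) := by
  intro hUL A hA w hw ε hε
  obtain ⟨C, hC, hcnt⟩ := hUL A hA
  -- the decay constant of `w`
  set D : ℝ := weilDecayW 0 w with hD_def
  have hD0 : 0 ≤ D := weilDecayW_nonneg 0 w
  -- the summable majorant over the windows
  have hsum : Summable (fun m : ℤ => (1 + (m : ℝ) ^ 2)⁻¹) :=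
    Literature.Analysis.FunctionSpaces.Torus.summable_inv_one_add_sq_int
  set S : ℝ := ∑' m : ℤ, (1 + (m : ℝ) ^ 2)⁻¹ with hS_def
  have hS0 : 0 ≤ S := tsum_nonneg fun m => by positivity
  -- the radius
  set R : ℝ := max 1 (8 * C * D ^ 2 * S / ε) with hR_def
  have hR1 : 1 ≤ R := le_max_left _ _
  have hR0 : 0 < R := one_pos.trans_le hR1
  have hRε : 8 * C * D ^ 2 * S ≤ ε * R := by
    have h : 8 * C * D ^ 2 * S / ε ≤ R := le_max_right _ _
    rw [div_le_iff₀ hε] at h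
    linarith
  refine ⟨R, hR0, fun ι γ hγ T F hF => ?_⟩
  have hLT : 0 ≤ Real.log (1 + |T|) := Real.log_nonneg (by linarith [abs_nonneg T])
  -- (1) per-atom bound, in terms of the window index `m = round (γ i - T)`
  have hatom : ∀ i ∈ F,
      ‖weilMellin w (1 / 2 + ((γ i - T : ℝ) : ℂ) * I)‖ ^ 2 ≤
        D ^ 2 * (8 / (R * (1 + |((round (γ i - T) : ℤ) : ℝ)|) *
          (1 + ((round (γ i - T) : ℤ) : ℝ) ^ 2))) := by
    intro i hi
    refine (norm_sq_weilMellin_half_line_le hw (γ i - T)).trans ?_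
    exact mul_le_mul_of_nonneg_left
      (inv_one_add_sq_sq_le hR1 (hF i hi) (abs_sub_round (γ i - T))) (sq_nonneg D)
  -- (2) per-window count, from the hypothesis at height `T + m`
  have hfib : ∀ m : ℤ,
      ((F.filter fun i => round (γ i - T) = m).card : ℝ) ≤
        C * ((1 + Real.log (1 + |T|)) * (1 + |(m : ℝ)|)) := by
    intro m
    have h1 : ((F.filter fun i => round (γ i - T) = m).card : ℝ) ≤
        C * (1 + Real.log (1 + |T + m|)) := by
      refine hcnt ι γ hγ (T + m) _ fun i hi => ?_
      obtain ⟨-, hm⟩ := Finset.mem_filter.mp hi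
      have h := abs_sub_round (γ i - T)
      rw [hm] at h
      rw [show γ i - (T + (m : ℝ)) = γ i - T - m by ring]
      linarith
    exact h1.trans (mul_le_mul_of_nonneg_left (one_add_log_abs_add_le T m) hC.le)
  -- (3) sort the atoms into windows and sum the window bounds
  have hmaps : ∀ i ∈ F, round (γ i - T) ∈ F.image fun i => round (γ i - T) :=
    fun i hi => Finset.mem_image_of_mem _ hi
  calc ∑ i ∈ F, ‖weilMellin w (1 / 2 + ((γ i - T : ℝ) : ℂ) * I)‖ ^ 2
      = ∑ m ∈ F.image (fun i => round (γ i - T)),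
          ∑ i ∈ F.filter (fun i => round (γ i - T) = m),
            ‖weilMellin w (1 / 2 + ((γ i - T : ℝ) : ℂ) * I)‖ ^ 2 :=
        (Finset.sum_fiberwise_of_maps_to hmaps _).symm
    _ ≤ ∑ m ∈ F.image (fun i => round (γ i - T)),
          ∑ i ∈ F.filter (fun i => round (γ i - T) = m),
            D ^ 2 * (8 / (R * (1 + |(m : ℝ)|) * (1 + (m : ℝ) ^ 2))) := by
        refine Finset.sum_le_sum fun m _ => Finset.sum_le_sum fun i hi => ?_
        obtain ⟨hiF, hm⟩ := Finset.mem_filter.mp hi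
        have h := hatom i hiF
        rwa [hm] at h
    _ = ∑ m ∈ F.image (fun i => round (γ i - T)),
          ((F.filter fun i => round (γ i - T) = m).card : ℝ) *
            (D ^ 2 * (8 / (R * (1 + |(m : ℝ)|) * (1 + (m : ℝ) ^ 2)))) := by
        refine Finset.sum_congr rfl fun m _ => ?_
        rw [Finset.sum_const, nsmul_eq_mul]
    _ ≤ ∑ m ∈ F.image (fun i => round (γ i - T)),
          C * ((1 + Real.log (1 + |T|)) * (1 + |(m : ℝ)|)) *
            (D ^ 2 * (8 / (R * (1 + |(m : ℝ)|) * (1 + (m : ℝ) ^ 2)))) := by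
        refine Finset.sum_le_sum fun m _ => ?_
        exact mul_le_mul_of_nonneg_right (hfib m) (by positivity)
    _ = ∑ m ∈ F.image (fun i => round (γ i - T)),
          8 * C * D ^ 2 * (1 + Real.log (1 + |T|)) / R * (1 + (m : ℝ) ^ 2)⁻¹ := by
        refine Finset.sum_congr rfl fun m _ => ?_
        have h1 : (0 : ℝ) < 1 + |(m : ℝ)| := by positivity
        have h2 : (0 : ℝ) < 1 + (m : ℝ) ^ 2 := by positivity
        field_simp
    _ = 8 * C * D ^ 2 * (1 + Real.log (1 + |T|)) / R *
          ∑ m ∈ F.image (fun i => round (γ i - T)), (1 + (m : ℝ) ^ 2)⁻¹ := by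
        rw [Finset.mul_sum]
    _ ≤ 8 * C * D ^ 2 * (1 + Real.log (1 + |T|)) / R * S := by
        refine mul_le_mul_of_nonneg_left ?_ (by positivity)
        exact hsum.sum_le_tsum _ fun m _ => by positivity
    _ ≤ ε * (1 + Real.log (1 + |T|)) := by
        rw [div_mul_eq_mul_div, div_le_iff₀ hR0]
        have h := mul_le_mul_of_nonneg_right hRε (by linarith : (0 : ℝ) ≤ 1 + Real.log (1 + |T|))
        nlinarith [h]

/-- Curried form of `stub_farTail`. [folklore] -/
theorem farTail_of_upperLawUniform
    (hUL : ∀ A : ℝ, 0 < A → ∃ C : ℝ, 0 < C ∧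
      ∀ (ι : Type) (γ : ι → ℝ),
        (∀ g : ℝ → ℂ, IsWeilTest g → tsupport g ⊆ Icc (-A) A →
          HasSum (fun i => weilMellin g (1 / 2 + (γ i : ℂ) * I)) (weilFunctional g)) →
        ∀ (T : ℝ) (s : Finset ι), (∀ i ∈ s, |γ i - T| ≤ 1) →
          (s.card : ℝ) ≤ C * (1 + Real.log (1 + |T|)))
    {A : ℝ} (hA : 0 < A) {w : ℝ → ℂ} (hw : IsWeilTest w) {ε : ℝ} (hε : 0 < ε) :
    ∃ R : ℝ, 0 < R ∧ ∀ (ι : Type) (γ : ι → ℝ),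
      (∀ g : ℝ → ℂ, IsWeilTest g → tsupport g ⊆ Icc (-A) A →
        HasSum (fun i => weilMellin g (1 / 2 + (γ i : ℂ) * I)) (weilFunctional g)) →
      ∀ (T : ℝ) (F : Finset ι), (∀ i ∈ F, R < |γ i - T|) →
        ∑ i ∈ F, ‖weilMellin w (1 / 2 + ((γ i - T : ℝ) : ℂ) * I)‖ ^ 2 ≤
          ε * (1 + Real.log (1 + |T|)) :=
  stub_farTail hUL A hA w hw ε hε

end Summit.RiemannHypothesis.RiemannHypothesis.Theorems.SpectralTraceWindowStep

end
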